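import Literature.MathematicalPhysics.QuantumLattice.TorusLimitAsymptoticGroundStateFamilies
import Literature.MathematicalPhysics.QuantumLattice.DWaveSourceEnergyDensityEnsembles
import HarnessLib

/-!
# Torus limits of SECTOR ground states of the `t–t'` Hubbard model: ground states of `H^{tt'} − μN` with the
# chemical potential in the subdifferential `[μ₋(n), μ₊(n)]`, hence charged / Nambu KKT blocks at one common `μ`
# WITHOUT finite-volume bracket hypotheses

Topic `Literature/MathematicalPhysics/QuantumLattice`; namespace = path. Companion (special case) of
`TorusLimitAsymptoticGroundStateFamilies.lean`: exact unit ground states `ψ_L` of `hubbardTorusTT' L t t' U` in the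
sectors `(rectN n L, S^z = 0)` satisfy its hypotheses (N) `Σ_σ Re⟨ψ, N_σψ⟩/L² = rectN n L/L² → n` and (E)
`Re⟨ψ, Hψ⟩/L² = E₀(rectN n L)/L² → e(t,t',U,n)` EXACTLY (`tendsto_number_energy_of_sectorGroundStates`), so every
torus limit `ω` (`U ≥ 0`, `0 < n < 2`) is a mean-energy minimiser and a Bratteli–Robinson ground state of
`hubbardTTPrimeMuInteraction t t' U μ` for some `μ ∈ [chemPotMinusTT', chemPotPlusTT'](n)`
(`IsTorusLimitOf.exists_groundState_hubbardTTPrimeMu_mem_Icc_of_sectorGroundStates`; the tree's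
`IsTorusLimitOf.exists_isMeanEnergyMinimiser_hubbardTTPrimeMu_of_sectorGroundStates` leaves `μ` unlocated), and
every PSD-weighted KKT block of `H^{tt'μ}_{Λ₁}` over ARBITRARY (charged, Nambu, spin-flip) local generators is
nonnegative in `ω` (`IsTorusLimitOf.exists_re_expect_kktForm_pencil_nonneg_of_sectorGroundStates`). Contrast
`IsTorusLimitOf.chargedStability_TT'` (`InfVolFermionStateTorusLimitChargedStability.lean`), valid for EVERY `μ`
inside FINITE-VOLUME pair-removal/addition brackets taken as hypotheses: here no finite-volume input, at the price
of an existential `μ` in the thermodynamic bracket — the form a certified `μ`-cover (sup over cells) consumes.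

§2 (appended): the WHOLE subdifferential supports — a translation-invariant state of density `n` and mean energy
`e(n)` is a minimiser and a ground state of `H^{tt'} − μN` for EVERY `μ ∈ [μ₋(n), μ₊(n)]`
(`IsTranslationInvariant.isMeanEnergyMinimiser_hubbardTTPrimeMu_of_mem_Icc`, chord inequality + Legendre floor), so
torus limits of asymptotically ground-state families and of sector ground states carry all ground-state rows (KKT
blocks included) at EVERY such `μ` (`IsTorusLimitOf.groundState_hubbardTTPrimeMu_of_mem_Icc_of_{asymptotic,sector}GroundStates`):
a certificate may be read at any ONE certified point of the subdifferential.

HONEST SCOPE. Soundness statements for charged ground-state rows on the production (two-point) relaxation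
objects of the Hubbard cells; `μ` is not computed; no number. Everything is PROVED; no definition, no named fact.

## References
* O. Bratteli, A. Kishimoto, D. W. Robinson, Commun. Math. Phys. 64 (1978) 41–48, Thm. 2.
  [cite: BratteliKishimotoRobinson1978, Thm. 2 (p. 47)]
* D. Ruelle, *Statistical Mechanics: Rigorous Results* (1969), §3.4. [cite: Ruelle1969, §3.4]
* O. Bratteli, D. W. Robinson, *OAQSM 2* (1997), §6.2.4. [cite: BratteliRobinsonII1997, §6.2.4]
* M. Araújo et al., arXiv:2311.18707, §3.2 Prop. 11. [cite: AraujoEtAl2023, §3.2 Prop. 11]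
-/

noncomputable section

namespace Literature.MathematicalPhysics.QuantumLattice

open _root_.Matrix Finset HubbardWave0 Literature.Probability.LatticeModels _root_.Filter ThermodynamicLimit
open Literature.MathematicalPhysics.QuantumManyBody.StateRelaxation
open scoped _root_.Topology ComplexOrder

section Sector

variable {ω : InfVolFermionState 2} {ψ : ∀ L, Fock (Orb (FermionTorus 2 L))} {Ls : ℕ → ℕ}

/-- **Sector ground states satisfy (N) and (E)**: for unit ground states `ψ_L` of `hubbardTorusTT' L t t' U` in
the sectors `(rectN n L, S^z = 0)` (`U ≥ 0`, `0 ≤ n < 2`) along `L_j → ∞`, the number densities are EXACTLY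
`rectN n L_j / L_j² → n` and the energies per site are EXACTLY `E₀(rectN n L_j)/L_j² → e(t,t',U,n)`.
[cite: BratteliRobinsonII1997, §6.2.4] -/
theorem tendsto_number_energy_of_sectorGroundStates (t t' : ℝ) {U n : ℝ} (hU : 0 ≤ U) (hn0 : 0 ≤ n)
    (hn2 : n < 2) (hLs : Tendsto Ls atTop atTop)
    (hψ : ∀ j, IsGroundStateInSector (hubbardTorusTT' (Ls j) t t' U) (rectN n (Ls j)) 0 (ψ (Ls j)))
    (hψ1 : ∀ j, star (ψ (Ls j)) ⬝ᵥ ψ (Ls j) = 1) :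
    Tendsto (fun j => (∑ σ : Fin 2,
        (star (ψ (Ls j)) ⬝ᵥ ((∑ y : FermionTorus 2 (Ls j), numberOp y σ) *ᵥ ψ (Ls j))).re) / ((Ls j : ℝ)) ^ 2)
      atTop (𝓝 n) ∧
    ∀ ε : ℝ, 0 < ε → ∀ᶠ j in atTop,
      (star (ψ (Ls j)) ⬝ᵥ (hubbardTorusTT' (Ls j) t t' U *ᵥ ψ (Ls j))).re / (Ls j : ℝ) ^ 2 ≤
        energyDensityTT' t t' U n + ε := by
  constructor
  · refine ((tendsto_rectN_div_sq hn0).comp hLs).congr' ?_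
    filter_upwards with j
    have hfill : ∀ σ : Fin 2,
        (star (ψ (Ls j)) ⬝ᵥ ((∑ y : FermionTorus 2 (Ls j), numberOp y σ) *ᵥ ψ (Ls j))).re =
          (rectN n (Ls j) : ℝ) / 2 := by
      intro σ
      rw [spinNumber_mulVec_of_mem_szSector σ (hψ j).1, dotProduct_smul, hψ1 j, smul_eq_mul, mul_one,
        Complex.ofReal_re]
    rw [Function.comp_apply, Fin.sum_univ_two, hfill 0, hfill 1, add_halves]
  · intro ε hε
    have hlim := (tendsto_energyDensityTT'_torus t t' hU hn0 hn2).comp hLs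
    have hev := (tendsto_order.1 hlim).2 _ (lt_add_of_pos_right _ hε)
    filter_upwards [hev, hLs.eventually_ge_atTop 1] with j hj hj1
    haveI : NeZero (Ls j) := ⟨by omega⟩
    rw [re_rayleigh_hubbardTorusTT'_of_isGroundStateInSector_rectN (Ls j) t t' U hn0 hn2.le (hψ j) (hψ1 j)]
    exact hj.le

/-- **Torus limits of sector ground states are minimisers and ground states of `H^{tt'} − μN` with
`μ ∈ [μ₋(n), μ₊(n)]`** (`U ≥ 0`, `0 < n < 2`) — the tree's
`IsTorusLimitOf.exists_isMeanEnergyMinimiser_hubbardTTPrimeMu_of_sectorGroundStates` with the chemical potential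
LOCATED in the subdifferential. [cite: BratteliKishimotoRobinson1978, Thm. 2 (p. 47)] [cite: Ruelle1969, §3.4] -/
theorem InfVolFermionState.IsTorusLimitOf.exists_groundState_hubbardTTPrimeMu_mem_Icc_of_sectorGroundStates
    (t t' : ℝ) {U n : ℝ} (hU : 0 ≤ U) (hn0 : 0 < n) (hn2 : n < 2) (h : ω.IsTorusLimitOf ψ Ls)
    (hLs : Tendsto Ls atTop atTop)
    (hψ : ∀ j, IsGroundStateInSector (hubbardTorusTT' (Ls j) t t' U) (rectN n (Ls j)) 0 (ψ (Ls j)))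
    (hψ1 : ∀ j, star (ψ (Ls j)) ⬝ᵥ ψ (Ls j) = 1) :
    ∃ μ ∈ Set.Icc (chemPotMinusTT' t t' U n) (chemPotPlusTT' t t' U n),
      ω.IsMeanEnergyMinimiser (hubbardTTPrimeMuInteraction t t' U μ) 1 ∧
      ω.IsGroundState (hubbardTTPrimeMuInteraction t t' U μ) 1 := by
  obtain ⟨hN, hE⟩ := tendsto_number_energy_of_sectorGroundStates t t' hU hn0.le hn2 hLs hψ hψ1
  exact h.exists_groundState_hubbardTTPrimeMu_mem_Icc_of_asymptoticGroundStates t t' hU hn0 hn2 hLs hN hE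

/-- **Charged / Nambu KKT blocks on torus limits of SECTOR ground states, at one common `μ` in the
subdifferential, with NO finite-volume bracket hypothesis** (contrast `IsTorusLimitOf.chargedStability_TT'`, which
is conditional on finite-volume pair-removal/addition brackets): for some `μ ∈ [μ₋(n), μ₊(n)]`, every PSD-weighted
KKT block of `H^{tt'μ}_{Λ₁}` over ARBITRARY local generators is nonnegative in `ω`.
[cite: BratteliKishimotoRobinson1978, Thm. 2 (p. 47)] [cite: AraujoEtAl2023, §3.2 Prop. 11] -/
theorem InfVolFermionState.IsTorusLimitOf.exists_re_expect_kktForm_pencil_nonneg_of_sectorGroundStates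
    (t t' : ℝ) {U n : ℝ} (hU : 0 ≤ U) (hn0 : 0 < n) (hn2 : n < 2) (h : ω.IsTorusLimitOf ψ Ls)
    (hLs : Tendsto Ls atTop atTop)
    (hψ : ∀ j, IsGroundStateInSector (hubbardTorusTT' (Ls j) t t' U) (rectN n (Ls j)) 0 (ψ (Ls j)))
    (hψ1 : ∀ j, star (ψ (Ls j)) ⬝ᵥ ψ (Ls j) = 1) :
    ∃ μ ∈ Set.Icc (chemPotMinusTT' t t' U n) (chemPotPlusTT' t t' U n),
      ω.IsMeanEnergyMinimiser (hubbardTTPrimeMuInteraction t t' U μ) 1 ∧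
      ∀ (Λ : Finset (Site 2)) {m : Type} [Fintype m] [DecidableEq m] {G : Matrix m m ℂ}, G.PosSemidef →
        ∀ B : m → FermionOp Λ,
          0 ≤ (ω.expect (thicken Λ 1)
            (kktForm ((hubbardTTPrimeMuInteraction t t' U μ).localHamiltonian (thicken Λ 1)) G
              (fun b => fermionEmbed (PolySite.incl (subset_thicken Λ 1)) (B b)))).re := by
  obtain ⟨μ, hμ, hmin, hgs⟩ :=
    h.exists_groundState_hubbardTTPrimeMu_mem_Icc_of_sectorGroundStates t t' hU hn0 hn2 hLs hψ hψ1
  exact ⟨μ, hμ, hmin, fun Λ m _ _ G hG B => hgs.re_expect_kktForm_nonneg hG B⟩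

end Sector

/-! ### §2. (appended 2026-08-27) The WHOLE subdifferential supports a fixed-density minimiser: the rows hold at
EVERY `μ ∈ [μ₋(n), μ₊(n)]`, not only at one -/

section AllMu

variable {ω : InfVolFermionState 2} {ψ : ∀ L, Fock (Orb (FermionTorus 2 L))} {Ls : ℕ → ℕ}

/-- **Every subgradient supports**: a translation-invariant state of density `n ∈ (0,2)` and `t–t'` mean energy
`e(t,t',U,n)` (`U ≥ 0`) is a mean-energy minimiser of `H^{tt'} − μN` for EVERY `μ ∈ [μ₋(n), μ₊(n)]`
(`e(n) − μn ≤ p(μ) ≤ e^{tt'}(σ) − μρ(σ)` for every translation-invariant `σ`: the chord inequality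
`energyDensityTT'_add_mul_le_of_mem_Icc` and the Legendre floor `gcEnergyDensityTT'_le_meanEnergy_hubbardTTPrimeMu`).
[cite: Ruelle1969, §3.4] -/
theorem InfVolFermionState.IsTranslationInvariant.isMeanEnergyMinimiser_hubbardTTPrimeMu_of_mem_Icc (t t' : ℝ)
    {U n μ : ℝ} (hU : 0 ≤ U) (hn0 : 0 < n) (hn2 : n < 2) (hω : ω.IsTranslationInvariant) (hρ : ω.density = n)
    (hme : ω.meanEnergy (hubbardTTPrimeFermionInteraction t t' U) 1 = energyDensityTT' t t' U n)
    (hμ : μ ∈ Set.Icc (chemPotMinusTT' t t' U n) (chemPotPlusTT' t t' U n)) :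
    ω.IsMeanEnergyMinimiser (hubbardTTPrimeMuInteraction t t' U μ) 1 := by
  refine ⟨hω, fun σ hσ => ?_⟩
  have hgc : energyDensityTT' t t' U n - μ * n ≤ gcEnergyDensityTT' t t' U μ := by
    refine le_gcEnergyDensityTT' fun m hm0 hm2 => ?_
    have h := energyDensityTT'_add_mul_le_of_mem_Icc t t' hU hn0 hn2 hμ.1 hμ.2 hm0 hm2
    linarith
  rw [InfVolFermionState.meanEnergy_hubbardTTPrimeMu, hρ, hme]
  exact hgc.trans (gcEnergyDensityTT'_le_meanEnergy_hubbardTTPrimeMu t t' hU μ hσ)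

/-- … **and a Bratteli–Robinson ground state of `H^{tt'} − μN` for every such `μ`** (Bratteli–Kishimoto–Robinson
`2 ⇒ 1`). [cite: BratteliKishimotoRobinson1978, Thm. 2 (p. 47)] -/
theorem InfVolFermionState.IsTranslationInvariant.isGroundState_hubbardTTPrimeMu_of_mem_Icc (t t' : ℝ)
    {U n μ : ℝ} (hU : 0 ≤ U) (hn0 : 0 < n) (hn2 : n < 2) (hω : ω.IsTranslationInvariant) (hρ : ω.density = n)
    (hme : ω.meanEnergy (hubbardTTPrimeFermionInteraction t t' U) 1 = energyDensityTT' t t' U n)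
    (hμ : μ ∈ Set.Icc (chemPotMinusTT' t t' U n) (chemPotPlusTT' t t' U n)) :
    ω.IsGroundState (hubbardTTPrimeMuInteraction t t' U μ) 1 :=
  (hω.isMeanEnergyMinimiser_hubbardTTPrimeMu_of_mem_Icc t t' hU hn0 hn2 hρ hme hμ).isGroundState two_pos
    (FermionInteraction.hasFiniteRange_pencil (hubbardTTPrimeFermionInteraction_hasFiniteRange t t' U)
      (numberInteraction_hasFiniteRange 1 zero_le_one) _)
    (FermionInteraction.isHermitian_pencil (hubbardTTPrimeFermionInteraction_isHermitian t t' U)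
      numberInteraction_isHermitian _)
    (FermionInteraction.isEven_pencil (hubbardTTPrimeFermionInteraction_isEven t t' U) numberInteraction_isEven _)
    (FermionInteraction.isTranslationInvariant_pencil (hubbardTTPrimeFermionInteraction_isTranslationInvariant t t' U)
      numberInteraction_isTranslationInvariant _)

/-- **Torus limits of asymptotically ground-state families are minimisers AND ground states of `H^{tt'} − μN` for
EVERY `μ ∈ [μ₋(n), μ₊(n)]`** (hence all ground-state rows, incl. every PSD-weighted KKT block of `H^{tt'μ}_{Λ₁}`
over arbitrary generators, hold at every such `μ` — a certificate may be read at ANY ONE certified point of the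
subdifferential; a `μ`-cover is needed only to locate one). [cite: KomaTasaki1994, §2.2] [cite: BratteliKishimotoRobinson1978, Thm. 2 (p. 47)] -/
theorem InfVolFermionState.IsTorusLimitOf.groundState_hubbardTTPrimeMu_of_mem_Icc_of_asymptoticGroundStates
    (t t' : ℝ) {U n μ : ℝ} (hU : 0 ≤ U) (hn0 : 0 < n) (hn2 : n < 2) (h : ω.IsTorusLimitOf ψ Ls)
    (hLs : Tendsto Ls atTop atTop)
    (hN : Tendsto (fun j => (∑ σ : Fin 2,
        (star (ψ (Ls j)) ⬝ᵥ ((∑ y : FermionTorus 2 (Ls j), numberOp y σ) *ᵥ ψ (Ls j))).re) / ((Ls j : ℝ)) ^ 2)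
      atTop (𝓝 n))
    (hE : ∀ ε : ℝ, 0 < ε → ∀ᶠ j in atTop,
      (star (ψ (Ls j)) ⬝ᵥ (hubbardTorusTT' (Ls j) t t' U *ᵥ ψ (Ls j))).re / (Ls j : ℝ) ^ 2 ≤
        energyDensityTT' t t' U n + ε)
    (hμ : μ ∈ Set.Icc (chemPotMinusTT' t t' U n) (chemPotPlusTT' t t' U n)) :
    ω.IsMeanEnergyMinimiser (hubbardTTPrimeMuInteraction t t' U μ) 1 ∧
      ω.IsGroundState (hubbardTTPrimeMuInteraction t t' U μ) 1 ∧
      ∀ (Λ : Finset (Site 2)) {m : Type} [Fintype m] [DecidableEq m] {G : Matrix m m ℂ}, G.PosSemidef →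
        ∀ B : m → FermionOp Λ,
          0 ≤ (ω.expect (thicken Λ 1)
            (kktForm ((hubbardTTPrimeMuInteraction t t' U μ).localHamiltonian (thicken Λ 1)) G
              (fun b => fermionEmbed (PolySite.incl (subset_thicken Λ 1)) (B b)))).re := by
  obtain ⟨hTI, hρ, hme, -⟩ := h.canonicalMinimiser_of_asymptoticGroundStates t t' hU hn0 hn2 hLs hN hE
  have hgs := hTI.isGroundState_hubbardTTPrimeMu_of_mem_Icc t t' hU hn0 hn2 hρ hme hμ
  exact ⟨hTI.isMeanEnergyMinimiser_hubbardTTPrimeMu_of_mem_Icc t t' hU hn0 hn2 hρ hme hμ, hgs,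
    fun Λ m _ _ G hG B => hgs.re_expect_kktForm_nonneg hG B⟩

/-- **Sector ground states, every `μ` in the subdifferential**: torus limits of unit `(rectN n L, S^z = 0)`-sector
ground states of `hubbardTorusTT' L t t' U` (`U ≥ 0`, `0 < n < 2`) are minimisers and ground states of
`H^{tt'} − μN`, with all PSD-weighted KKT blocks nonnegative, for EVERY `μ ∈ [μ₋(n), μ₊(n)]` — the
thermodynamic-limit form of `IsTorusLimitOf.chargedStability_TT'` with NO finite-volume bracket hypothesis.
[cite: BratteliKishimotoRobinson1978, Thm. 2 (p. 47)] [cite: AraujoEtAl2023, §3.2 Prop. 11] -/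
theorem InfVolFermionState.IsTorusLimitOf.groundState_hubbardTTPrimeMu_of_mem_Icc_of_sectorGroundStates
    (t t' : ℝ) {U n μ : ℝ} (hU : 0 ≤ U) (hn0 : 0 < n) (hn2 : n < 2) (h : ω.IsTorusLimitOf ψ Ls)
    (hLs : Tendsto Ls atTop atTop)
    (hψ : ∀ j, IsGroundStateInSector (hubbardTorusTT' (Ls j) t t' U) (rectN n (Ls j)) 0 (ψ (Ls j)))
    (hψ1 : ∀ j, star (ψ (Ls j)) ⬝ᵥ ψ (Ls j) = 1)
    (hμ : μ ∈ Set.Icc (chemPotMinusTT' t t' U n) (chemPotPlusTT' t t' U n)) :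
    ω.IsMeanEnergyMinimiser (hubbardTTPrimeMuInteraction t t' U μ) 1 ∧
      ω.IsGroundState (hubbardTTPrimeMuInteraction t t' U μ) 1 ∧
      ∀ (Λ : Finset (Site 2)) {m : Type} [Fintype m] [DecidableEq m] {G : Matrix m m ℂ}, G.PosSemidef →
        ∀ B : m → FermionOp Λ,
          0 ≤ (ω.expect (thicken Λ 1)
            (kktForm ((hubbardTTPrimeMuInteraction t t' U μ).localHamiltonian (thicken Λ 1)) G
              (fun b => fermionEmbed (PolySite.incl (subset_thicken Λ 1)) (B b)))).re := by
  obtain ⟨hN, hE⟩ := tendsto_number_energy_of_sectorGroundStates t t' hU hn0.le hn2 hLs hψ hψ1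
  exact h.groundState_hubbardTTPrimeMu_of_mem_Icc_of_asymptoticGroundStates t t' hU hn0 hn2 hLs hN hE hμ

end AllMu

end Literature.MathematicalPhysics.QuantumLattice

end
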